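import Summits.Langlands.Langlands.Theses.IrreducibilityBySelfDuality
import Summits.Langlands.Langlands.Theorems.IrreducibilityBySelfDualityIrreducibleOffSectorArtinType
import HarnessLib

/-!
# The Galois-type region of `IrreducibleOffSector`: rigidity of the avatars, and the crux's shape
(crux stmt-Langlands-14329 `IrreducibilityBySelfDuality.IrreducibleOffSector`, route
`route-Langlands-IrreducibilityBySelfDuality`, line `Sketch`; `--supports` file, lead c3; sequel of
`…IrreducibleOffSectorArtinType`, p119699)

`…ArtinType` proves the Galois-type region in its natural generality
(`isIrreducible_of_isPiOfArtinRep`: ANY automorphic representation datum `π` of `GL_n(𝔸_K)` with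
`π = π(σ)` for an irreducible Artin `σ`; every a.e.-compatible `ρ : Γ_K →ₜ* GL_n(ℚ̄_ℓ)` is
irreducible).  This sequel adds the UNIQUENESS half of reciprocity on that region and records the
region in the crux's own shape:

* `exists_eq_conj_lAdicDualTransport_of_isPiOfArtinRep` — **rigidity**: every a.e.-compatible `ρ` is
  `P ρ₀ P⁻¹` for the `ℓ`-adic transport `ρ₀` of `σ^∨` (irreducible ⇒ semisimple; Chebotarev +
  Brauer–Nesbitt give `ρ ≃ ρ₀`; equivalent framed representations are conjugate) — clause (A)'s
  uniqueness-up-to-conjugacy on the region;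
* `finite_range_and_isUnramifiedAt_iff_of_isPiOfArtinRep` — hence every such `ρ` has finite image and
  is unramified at exactly the places where `σ` is (`finite_range_of_ker_iff`);
* `isIrreducible_of_isPiOfArtinRep'` — the region for the fact-free leaf predicate
  `ArtinAutomorphy.IsPiOfArtinRep` (byte-identical copy of `IsPiOfArtinRep`, definitionally equal);
* `irreducibleOffSector_conclusion_of_isPiOfArtinRep` — the region in the exact binder shape of the
  crux (`∀ n K hcpt, 0 < n → ∀ π` cuspidal, [Galois type], L-algebraic, off the sector, `∀ ℓ ι ρ`
  a.e.-compatible ⇒ irreducible): the guard, L-algebraicity and the off-sector clause are idle and NO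
  reciprocity / Rankin–Selberg input (items 14328, 13622, the (2.3) fact) is consumed;
* `irreducibleOffSector_of_forall_isPiOfArtinRep` — shape check against the crux BY NAME: it would
  follow outright if every L-algebraic cuspidal `π` off the sector were of Galois type (false as soon
  as some `π` has an infinite-image avatar; recorded only to certify the shape).

References: Deligne–Serre, ASENS 7 (1974), Lemme 3.2; Serre, *Abelian ℓ-adic representations* (1968),
Ch. I §1.1 Remark; Tunnell, Bull. AMS 5 (1981) p. 173; Ramakrishnan, *Irreducibility and
cuspidality* (2008), Introduction.
-/

noncomputable section

-- `Summit.Langlands.Langlands.…` (summit = sub-problem name, D-0017 layout) trips `dupNamespace`.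
set_option linter.dupNamespace false

open scoped NumberField Classical Matrix
open Filter IsDedekindDomain
open Literature.NumberTheory.Automorphic Literature.NumberTheory.GaloisRepresentations
open Summit.Langlands.Langlands.Theses.IrreducibilityBySelfDuality

namespace Summit.Langlands.Langlands.Theorems.IrreducibleOffSector

/-! ## 1. Uniqueness on the Galois-type region: every avatar is the transport, up to a frame -/

section Rigidity

variable {K : Type} [Field K] [NumberField K] {n ℓ : ℕ} [Fact ℓ.Prime]

/-- The transport `ρ₀` of `exists_lAdicDualTransport` has FINITE IMAGE: its kernel is the kernel of
`σ` (kernel dictionary), which is open (`FramedArtinRep.isOpen_ker_toMonoidHom`), hence of finite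
index in the compact group `Γ_K` (Mathlib `Subgroup.quotient_finite_of_isOpen`).
[cite: SerreAbelianLadic1968, Ch. I §1.1 Remark] -/
theorem finite_range_of_ker_iff (σ : FramedArtinRep K n) {ρ₀ : FramedGaloisRep K (PadicAlgCl ℓ) n}
    (hker : ∀ g : Field.absoluteGaloisGroup K, ρ₀ g = 1 ↔ σ g = 1) :
    Finite ρ₀.toMonoidHom.range := by
  have hk : ρ₀.toMonoidHom.ker = σ.toMonoidHom.ker := by
    ext g
    rw [MonoidHom.mem_ker, MonoidHom.mem_ker]
    exact hker g
  haveI : Finite (Field.absoluteGaloisGroup K ⧸ ρ₀.toMonoidHom.ker) := by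
    rw [hk]
    exact Subgroup.quotient_finite_of_isOpen _ (FramedArtinRep.isOpen_ker_toMonoidHom σ)
  exact Finite.of_equiv _ (QuotientGroup.quotientKerEquivRange ρ₀.toMonoidHom).toEquiv

/-- **Rigidity on the Galois-type region: every a.e.-compatible `ρ` is a conjugate of the transport of
`σ^∨`.**  If `π = π(σ)` for an irreducible Artin `σ` and `ρ : Γ_K →ₜ* GL_n(ℚ̄_ℓ)` is Satake–Frobenius
compatible with `(π, ι)` at almost all places, then `ρ = P ρ₀ P⁻¹` for the transport `ρ₀` of `σ^∨` along
`ι⁻¹` (`ρ₀(g) = ι⁻¹(((σ g)⁻¹)ᵀ)`) and some `P ∈ GL_n(ℚ̄_ℓ)`: `ρ` is irreducible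
(`isIrreducible_of_isPiOfArtinRep`), hence semisimple, and two semisimple representations with common
Frobenius characteristic polynomials a.e. are equivalent (Chebotarev + Brauer–Nesbitt,
`FramedGaloisRep.nonempty_equiv_of_hasFrobCharpolyAt_eventually` with the proved `chebotarev_artinRep_holds`),
hence conjugate (`FramedRep.exists_eq_conj_of_equiv`).  This is clause (A)'s uniqueness-up-to-conjugacy on
the region. [cite: DeligneSerreASENS1974, Lemme 3.2] -/
theorem exists_eq_conj_lAdicDualTransport_of_isPiOfArtinRep {K : Type} [Field K] [NumberField K]
    {n ℓ : ℕ} [Fact ℓ.Prime] {hcpt : isCompact_glFiniteIntegralLevel n K}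
    (π : AutomorphicRepData (AutomorphyDatum.gl n K hcpt)) {σ : FramedArtinRep K n}
    (hσ : σ.toGaloisRep.IsIrreducible) (hπ : IsPiOfArtinRep σ π)
    (ι : PadicAlgCl ℓ ≃+* ℂ) (ρ : FramedGaloisRep K (PadicAlgCl ℓ) n)
    (hρ : ∀ᶠ v : HeightOneSpectrum (𝓞 K) in cofinite, SatakeFrobCompatibleAt ι π ρ v) :
    ∃ ρ₀ : FramedGaloisRep K (PadicAlgCl ℓ) n,
      (∀ g : Field.absoluteGaloisGroup K,
        ((ρ₀ g : GL (Fin n) (PadicAlgCl ℓ)) : Matrix (Fin n) (Fin n) (PadicAlgCl ℓ)) =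
          ((((σ g)⁻¹ : GL (Fin n) ℂ) : Matrix (Fin n) (Fin n) ℂ)ᵀ).map (ι.symm : ℂ → PadicAlgCl ℓ)) ∧
      (∀ g : Field.absoluteGaloisGroup K, ρ₀ g = 1 ↔ σ g = 1) ∧
      ∃ P : GL (Fin n) (PadicAlgCl ℓ), ρ = ρ₀.conj P := by
  obtain ⟨ρ₀, hρ₀, hker, hirr⟩ := exists_lAdicDualTransport σ ι
  have h₀ := eventually_satakeFrobCompatibleAt_lAdicDualTransport hπ ι hρ₀ hker
  have hirr₀ : ρ₀.toGaloisRep.IsIrreducible := hirr hσ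
  have hirrρ : ρ.toGaloisRep.IsIrreducible := isIrreducible_of_satakeFrobCompatible π ι hirr₀ h₀ hρ
  obtain ⟨e⟩ := FramedGaloisRep.nonempty_equiv_of_hasFrobCharpolyAt_eventually
    chebotarev_artinRep_holds ρ₀ ρ (isSemisimple_of_isIrreducible ρ₀ hirr₀)
    (isSemisimple_of_isIrreducible ρ hirrρ) (eventually_hasFrobCharpolyAt_common π ι h₀ hρ)
  obtain ⟨P, hP⟩ := FramedRep.exists_eq_conj_of_equiv ρ₀ ρ e
  exact ⟨ρ₀, hρ₀, hker, P, hP⟩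

/-- **Consequences of rigidity**: on the Galois-type region every a.e.-compatible `ρ` has FINITE IMAGE
and is unramified at EXACTLY the places where `σ` is (both properties are invariant under change of
frame and hold for the transport by the kernel dictionary). [cite: DeligneSerreASENS1974, Lemme 3.2] -/
theorem finite_range_and_isUnramifiedAt_iff_of_isPiOfArtinRep {hcpt : isCompact_glFiniteIntegralLevel n K}
    (π : AutomorphicRepData (AutomorphyDatum.gl n K hcpt)) {σ : FramedArtinRep K n}
    (hσ : σ.toGaloisRep.IsIrreducible) (hπ : IsPiOfArtinRep σ π)
    (ι : PadicAlgCl ℓ ≃+* ℂ) (ρ : FramedGaloisRep K (PadicAlgCl ℓ) n)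
    (hρ : ∀ᶠ v : HeightOneSpectrum (𝓞 K) in cofinite, SatakeFrobCompatibleAt ι π ρ v) :
    Finite ρ.toMonoidHom.range ∧
      ∀ v : HeightOneSpectrum (𝓞 K), ρ.IsUnramifiedAt v ↔ σ.IsUnramifiedAt v := by
  obtain ⟨ρ₀, -, hker, P, rfl⟩ := exists_eq_conj_lAdicDualTransport_of_isPiOfArtinRep π hσ hπ ι ρ hρ
  refine ⟨?_, fun v => ?_⟩
  · haveI := finite_range_of_ker_iff σ hker
    have hrange : (ρ₀.conj P).toMonoidHom.range = ρ₀.toMonoidHom.range.map (MulAut.conj P).toMonoidHom := by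
      rw [← MonoidHom.range_comp]; rfl
    rw [hrange]
    exact Finite.of_surjective _ (MonoidHom.subgroupMap_surjective (MulAut.conj P).toMonoidHom _)
  · rw [FramedGaloisRep.isUnramifiedAt_conj_iff]
    refine forall₂_congr fun 𝔓 _ => forall₂_congr fun g _ => ?_
    exact hker g

end Rigidity

/-! ## 2. The region in the crux's shape -/

section Shape

/-- **The Galois-type region, for the fact-free leaf predicate** `ArtinAutomorphy.IsPiOfArtinRep`
(byte-identical to `IsPiOfArtinRep` of `StrongArtinGL2`, hence definitionally equal): if `π = π(σ)`
for an irreducible Artin `σ : Γ_K → GL_n(ℂ)`, every `ρ : Γ_K →ₜ* GL_n(ℚ̄_ℓ)` Satake–Frobenius compatible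
with `(π, ι)` at almost all places is irreducible. [cite: Tunnell1981, p. 173]
[cite: DeligneSerreASENS1974, Lemme 3.2] -/
theorem isIrreducible_of_isPiOfArtinRep' {K : Type} [Field K] [NumberField K] {n ℓ : ℕ}
    [Fact ℓ.Prime] {hcpt : isCompact_glFiniteIntegralLevel n K}
    (π : AutomorphicRepData (AutomorphyDatum.gl n K hcpt)) {σ : FramedArtinRep K n}
    (hσ : σ.toGaloisRep.IsIrreducible) (hπ : ArtinAutomorphy.IsPiOfArtinRep σ π)
    (ι : PadicAlgCl ℓ ≃+* ℂ) (ρ : FramedGaloisRep K (PadicAlgCl ℓ) n)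
    (hρ : ∀ᶠ v : HeightOneSpectrum (𝓞 K) in cofinite, SatakeFrobCompatibleAt ι π ρ v) :
    ρ.toGaloisRep.IsIrreducible :=
  isIrreducible_of_isPiOfArtinRep π hσ hπ ι ρ hρ

/-- **The Galois-type region in the binder shape of the crux `IrreducibleOffSector`.**  For every
`n`, every number field `K`, every cuspidal `π` of `GL_n(𝔸_K)` which is `π(σ)` for SOME irreducible
Artin `σ : Γ_K → GL_n(ℂ)`, and every `ℓ`, `ι`, `ρ` Satake–Frobenius compatible with `(π, ι)` a.e.,
`ρ` is irreducible — with the crux's other binders (`0 < n`, `IsLAlgebraic`, off-sector) carried and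
unused.  Unconditional: no reciprocity or Rankin–Selberg input. [cite: DeligneSerreASENS1974, Lemme 3.2]
[cite: Tunnell1981, p. 173] -/
theorem irreducibleOffSector_conclusion_of_isPiOfArtinRep :
    ∀ (n : ℕ) (K : Type) [Field K] [NumberField K] (hcpt : isCompact_glFiniteIntegralLevel n K),
      0 < n → ∀ (π : CuspidalAutomorphicRepData n K hcpt),
        (∃ σ : FramedArtinRep K n, σ.toGaloisRep.IsIrreducible ∧ IsPiOfArtinRep σ π.1) →
        π.1.IsLAlgebraic →
        ¬ (n = 3 ∧ NumberField.IsCMField K ∧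
            ∃ T : InfinityType K n, π.1.HasInfinityType T ∧ T.IsRegular) →
        ∀ (ℓ : ℕ) [Fact ℓ.Prime] (ι : PadicAlgCl ℓ ≃+* ℂ) (ρ : FramedGaloisRep K (PadicAlgCl ℓ) n),
          (∀ᶠ v : HeightOneSpectrum (𝓞 K) in cofinite, SatakeFrobCompatibleAt ι π.1 ρ v) →
          ρ.toGaloisRep.IsIrreducible := by
  intro n K _ _ hcpt _ π hGal _ _ ℓ _ ι ρ hρ
  obtain ⟨σ, hσ, hπ⟩ := hGal
  exact isIrreducible_of_isPiOfArtinRep π.1 hσ hπ ι ρ hρ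

/-- **Shape check against the crux BY NAME**: `IrreducibleOffSector` follows from the (false in
general, see the module docstring) hypothesis that every L-algebraic cuspidal `π` off the sector is of
Galois type — i.e. the region theorem has exactly the crux's shape; the honest content is
`irreducibleOffSector_conclusion_of_isPiOfArtinRep`. [folklore] -/
theorem irreducibleOffSector_of_forall_isPiOfArtinRep
    (hGal : ∀ (n : ℕ) (K : Type) [Field K] [NumberField K] (hcpt : isCompact_glFiniteIntegralLevel n K),
      0 < n → ∀ (π : CuspidalAutomorphicRepData n K hcpt), π.1.IsLAlgebraic →
        ¬ (n = 3 ∧ NumberField.IsCMField K ∧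
            ∃ T : InfinityType K n, π.1.HasInfinityType T ∧ T.IsRegular) →
        ∃ σ : FramedArtinRep K n, σ.toGaloisRep.IsIrreducible ∧ IsPiOfArtinRep σ π.1) :
    IrreducibleOffSector := by
  intro n K _ _ hcpt hn π hL hoff ℓ _ ι ρ hρ
  exact irreducibleOffSector_conclusion_of_isPiOfArtinRep n K hcpt hn π (hGal n K hcpt hn π hL hoff)
    hL hoff ℓ ι ρ hρ

end Shape

end Summit.Langlands.Langlands.Theorems.IrreducibleOffSector

end
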